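import Literature.RepresentationTheory.ModularTensorCategories.ModularDatum

/-!
# Gauge covariance of the pentagon equation

Topic `Literature/RepresentationTheory/ModularTensorCategories` (definition item `defn-ModularDatum`; tool
for transporting the Kauffman–Lins pentagon identity to the unitary `SU(2)_k` F-symbols).

If two systems of (multiplicity-free, zero-extended) F-symbols differ by a **vertex/line rescaling**
`G^{abc}_{d;ef} = F^{abc}_{d;ef} · u(a,b,e) u(e,c,d) v(f) / (u(b,c,f) u(a,f,d) v(e))` with nonvanishing
`u, v`, then `F` satisfies the pentagon equation (in the index form of `PreModularDatum.pentagon`) iff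
`G` does: in each pentagon term the rescaling factors of the summed label cancel and the remaining
factor is the same on both sides (`pentagon_of_gauge`). [cite: Kitaev2006, App. E.6 (gauge freedom: basis changes Γ^{ab}_c in V^{ab}_c act on F by such rescalings)]
-/

noncomputable section

namespace Literature.RepresentationTheory.ModularTensorCategories

universe u

variable {L : Type u} [Fintype L]

/-- **Gauge covariance of the pentagon**: if `G = F · u(a,b,e)u(e,c,d)v(f)/(u(b,c,f)u(a,f,d)v(e))`
with `u, v` nonvanishing and `F` satisfies the pentagon equation
`F^{fcd}_{e;gl} F^{abl}_{e;fk} = Σ_h F^{abc}_{g;fh} F^{ahd}_{e;gk} F^{bcd}_{k;hl}`, then so does `G`.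
[cite: Kitaev2006, App. E.6 (gauge freedom in the description of anyons)] -/
theorem pentagon_of_gauge (F G : L → L → L → L → L → L → ℂ) (u : L → L → L → ℂ) (v : L → ℂ)
    (hu : ∀ a b c, u a b c ≠ 0) (hv : ∀ a, v a ≠ 0)
    (hG : ∀ a b c d e f, G a b c d e f =
      F a b c d e f * (u a b e * u e c d * v f) / (u b c f * u a f d * v e))
    (hF : ∀ a b c d e f g k l,
      F f c d e g l * F a b l e f k = ∑ h, F a b c g f h * F a h d e g k * F b c d k h l) :
    ∀ a b c d e f g k l,
      G f c d e g l * G a b l e f k = ∑ h, G a b c g f h * G a h d e g k * G b c d k h l := by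
  intro a b c d e f g k l
  have hne : ∀ x y : ℂ, x ≠ 0 → y ≠ 0 → x * y ≠ 0 := fun x y => mul_ne_zero
  -- common gauge factor Φ = NΦ / DΦ
  set NΦ : ℂ := u a b f * u f c g * u g d e * v k * v l with hN
  set DΦ : ℂ := u a k e * u c d l * u b l k * v f * v g with hD
  have hDΦ : DΦ ≠ 0 := by rw [hD]; simp [hu, hv]
  have hL : G f c d e g l * G a b l e f k = NΦ / DΦ * (F f c d e g l * F a b l e f k) := by
    rw [hG, hG, div_mul_div_comm, div_mul_eq_mul_div, div_eq_div_iff (by simp [hu, hv]) hDΦ, hN, hD]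
    ring
  have hR : ∀ h, G a b c g f h * G a h d e g k * G b c d k h l =
      NΦ / DΦ * (F a b c g f h * F a h d e g k * F b c d k h l) := by
    intro h
    rw [hG, hG, hG, div_mul_div_comm, div_mul_div_comm, div_mul_eq_mul_div,
      div_eq_div_iff (by simp [hu, hv]) hDΦ, hN, hD]
    ring
  rw [hL, hF, Finset.mul_sum]
  exact Finset.sum_congr rfl (fun h _ => (hR h).symm)

/-- The same with the roles of `F` and `G` exchanged (the rescaling is invertible). [cite: Kitaev2006, App. E.6] -/
theorem pentagon_iff_of_gauge (F G : L → L → L → L → L → L → ℂ) (u : L → L → L → ℂ) (v : L → ℂ)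
    (hu : ∀ a b c, u a b c ≠ 0) (hv : ∀ a, v a ≠ 0)
    (hG : ∀ a b c d e f, G a b c d e f =
      F a b c d e f * (u a b e * u e c d * v f) / (u b c f * u a f d * v e)) :
    (∀ a b c d e f g k l,
      F f c d e g l * F a b l e f k = ∑ h, F a b c g f h * F a h d e g k * F b c d k h l) ↔
    (∀ a b c d e f g k l,
      G f c d e g l * G a b l e f k = ∑ h, G a b c g f h * G a h d e g k * G b c d k h l) := by
  constructor
  · exact pentagon_of_gauge F G u v hu hv hG
  · intro hGp
    refine pentagon_of_gauge G F (fun a b c => (u a b c)⁻¹) (fun a => (v a)⁻¹)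
      (fun a b c => inv_ne_zero (hu a b c)) (fun a => inv_ne_zero (hv a)) ?_ hGp
    intro a b c d e f
    have hN0 : u a b e * u e c d * v f ≠ 0 := by simp [hu, hv]
    have hD0 : u b c f * u a f d * v e ≠ 0 := by simp [hu, hv]
    rw [hG, show (u a b e)⁻¹ * (u e c d)⁻¹ * (v f)⁻¹ = (u a b e * u e c d * v f)⁻¹ by
        rw [mul_inv, mul_inv],
      show (u b c f)⁻¹ * (u a f d)⁻¹ * (v e)⁻¹ = (u b c f * u a f d * v e)⁻¹ by rw [mul_inv, mul_inv],
      div_eq_mul_inv, inv_inv, div_eq_mul_inv]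
    calc F a b c d e f = F a b c d e f * 1 * 1 := by ring
      _ = F a b c d e f * ((u a b e * u e c d * v f) * (u a b e * u e c d * v f)⁻¹) *
            ((u b c f * u a f d * v e)⁻¹ * (u b c f * u a f d * v e)) := by
          rw [mul_inv_cancel₀ hN0, inv_mul_cancel₀ hD0]
      _ = _ := by ring

end Literature.RepresentationTheory.ModularTensorCategories
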